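import Literature.AlgebraicGeometry.Resolution.AlterationsCodimThreeNodalFormParts
import Literature.AlgebraicGeometry.Resolution.RegularLocalRingsJacobian
import Literature.AlgebraicGeometry.Resolution.AdicNoetherian
import Mathlib.RingTheory.MvPowerSeries.NoZeroDivisors
import Mathlib.RingTheory.MvPowerSeries.Rename
import Mathlib.RingTheory.Ideal.KrullsHeightTheorem
import Mathlib.RingTheory.KrullDimension.NonZeroDivisors
import HarnessLib

/-!
# `k⟦u, v, t⟧/(uv - ∏ tⱼ^{nⱼ})` is singular in codimension two along `u = v = tᵢ = 0` if `nᵢ ≥ 2`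

Topic: `Literature/AlgebraicGeometry/Resolution`. The explicit half of the first sentence of
de Jong 1996, 3.5 ("Looking at the equations `Q - t₁^{n₁} ⋯ t_r^{n_r}` for a point
`x ∈ Sing(X)` as in 3.3, we see that we must have `nᵢ ∈ {0, 1}`"; cf. 3.4: "`B → A'⟦u, v⟧/
(u, v, tᵢ)` … The integer `nᵢ` must be `≥ 2`, otherwise `X` is regular along the generic point
of `T`"): in the formal model `B = k⟦u, v, t₁, …, t_m⟧/(F)`, `F = uv - ∏ⱼ tⱼ^{nnⱼ}`
(`DeJong1996.NodalPowRing k m nn`, `AlterationsCodimThreeNodalFormParts.lean`), if some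
`nnᵢ ≥ 2` then `𝔓 = (u, v, tᵢ)/(F)` is a prime of `B` with `B_𝔓` NOT regular and
`dim B_𝔓 ≤ 2`: `P = (u, v, tᵢ)` is a prime of `k⟦u, v, t⟧` of height `≤ 3` (Krull), and
`0 ≠ F ∈ P²`, so `B_𝔓 ≅ k⟦u, v, t⟧_P/(F)` has dimension `≤ 2` and the embedding dimension of
`k⟦u, v, t⟧_P`.

* `MvPowerSeries.ker_killCompl_eq_span`, `MvPowerSeries.isPrime_span_X_image` — the ideal of
  a power series ring generated by finitely many of the variables is the kernel of the map
  killing them, hence prime over a domain.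
* `not_isRegularLocalRing_quotient_span_singleton_of_mem_sq'` — a Noetherian local ring modulo
  a non-zero-divisor lying in `𝔪²` is not regular (Matsumura, Thm. 14.2, without assuming the
  ring regular).
* `DeJong1996.exists_prime_nodalPowRing_not_isRegularLocalRing` — the statement above.

## Sources

* A. J. de Jong, *Smoothness, semi-stability and alterations*, Publ. Math. IHÉS 83 (1996),
  3.4–3.5, pp. 63–64.
* H. Matsumura, *Commutative Ring Theory* (1986), Thm. 13.5 (Krull's height theorem), Thm. 14.2.
-/

noncomputable section

open IsLocalRing

namespace Literature.AlgebraicGeometry.Resolution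

universe u

/-! ## Ideals generated by variables in power series rings -/

section Variables

variable {σ : Type*} {R : Type*} [CommRing R]

/-- Splitting off the part of a power series divisible by one variable: `f = X_c · g + h` with
`h` collecting exactly the terms of `f` not involving `X_c`. [folklore] -/
theorem MvPowerSeries.exists_eq_X_mul_add (c : σ) (f : MvPowerSeries σ R) :
    ∃ g h : MvPowerSeries σ R, f = MvPowerSeries.X c * g + h ∧
      ∀ x : σ →₀ ℕ, MvPowerSeries.coeff x h =
        if x c = 0 then MvPowerSeries.coeff x f else 0 := by
  classical
  let h : MvPowerSeries σ R := fun x => if x c = 0 then MvPowerSeries.coeff x f else 0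
  have hh : ∀ x, MvPowerSeries.coeff x h = if x c = 0 then MvPowerSeries.coeff x f else 0 :=
    fun x => rfl
  obtain ⟨g, hg⟩ : (MvPowerSeries.X c : MvPowerSeries σ R) ∣ f - h :=
    MvPowerSeries.X_dvd_iff.mpr fun x hx => by rw [map_sub, hh, if_pos hx, sub_self]
  exact ⟨g, h, by rw [← hg]; ring, hh⟩

/-- A power series all of whose coefficients at monomials avoiding the finitely many variables
`X_c`, `c ∈ C`, vanish lies in the ideal `(X_c : c ∈ C)`. [folklore] -/
theorem MvPowerSeries.mem_span_X_image_of_coeff_eq_zero (C : Finset σ) (f : MvPowerSeries σ R)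
    (hf : ∀ x : σ →₀ ℕ, (∀ c ∈ C, x c = 0) → MvPowerSeries.coeff x f = 0) :
    f ∈ Ideal.span ((fun c => (MvPowerSeries.X c : MvPowerSeries σ R)) '' (C : Set σ)) := by
  classical
  induction C using Finset.induction_on generalizing f with
  | empty =>
    have h0 : f = 0 := by
      ext x
      simpa using hf x (by simp)
    rw [h0]
    exact Ideal.zero_mem _
  | insert c C hc ih =>
    obtain ⟨g, h, hfgh, hh⟩ := MvPowerSeries.exists_eq_X_mul_add c f
    have hmem : h ∈ Ideal.span
        ((fun c => (MvPowerSeries.X c : MvPowerSeries σ R)) '' (C : Set σ)) := by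
      refine ih h fun x hx => ?_
      rw [hh]
      by_cases hxc : x c = 0
      · rw [if_pos hxc]
        refine hf x fun c' hc' => ?_
        rcases Finset.mem_insert.mp hc' with rfl | h'
        · exact hxc
        · exact hx c' h'
      · rw [if_neg hxc]
    rw [hfgh]
    refine Ideal.add_mem _ (Ideal.mul_mem_right _ _ (Ideal.subset_span ⟨c, by simp, rfl⟩)) ?_
    exact Ideal.span_mono (Set.image_mono (by simp)) hmem

/-- **The kernel of killing finitely many variables** `k⟦Xₛ : s ∈ σ⟧ → k⟦X_t : t ∈ τ⟧`
(Mathlib's `MvPowerSeries.killCompl` along `τ ↪ σ`) is the ideal generated by the killed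
variables, provided these are finite in number. [folklore] -/
theorem MvPowerSeries.ker_killCompl_eq_span {τ : Type*} (e : τ ↪ σ) (C : Finset σ)
    (hC : ∀ s, s ∈ C ↔ s ∉ Set.range e) :
    RingHom.ker (MvPowerSeries.killCompl (R := R) e).toRingHom =
      Ideal.span ((fun c => (MvPowerSeries.X c : MvPowerSeries σ R)) '' (C : Set σ)) := by
  classical
  apply le_antisymm
  · intro f hf
    rw [RingHom.mem_ker] at hf
    refine MvPowerSeries.mem_span_X_image_of_coeff_eq_zero C f fun x hx => ?_
    have hsupp : ↑x.support ⊆ Set.range e := by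
      intro s hs
      by_contra hse
      exact (Finsupp.mem_support_iff.mp hs) (hx s ((hC s).mpr hse))
    rw [← Finsupp.embDomain_comapDomain hsupp, ← MvPowerSeries.coeff_killCompl]
    change MvPowerSeries.coeff _ ((MvPowerSeries.killCompl e).toRingHom f) = 0
    rw [hf, map_zero]
  · rw [Ideal.span_le]
    rintro _ ⟨c, hc, rfl⟩
    rw [SetLike.mem_coe, RingHom.mem_ker]
    exact MvPowerSeries.killCompl_X_eq_zero ((hC c).mp hc)

/-- Over a domain, the ideal of a power series ring generated by finitely many variables
(the complement of the range of `τ ↪ σ`) is prime: it is the kernel of the map killing them,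
whose target `R⟦X_t : t ∈ τ⟧` is a domain. [folklore] -/
theorem MvPowerSeries.isPrime_span_X_image [IsDomain R] {τ : Type*} (e : τ ↪ σ) (C : Finset σ)
    (hC : ∀ s, s ∈ C ↔ s ∉ Set.range e) :
    (Ideal.span ((fun c => (MvPowerSeries.X c : MvPowerSeries σ R)) '' (C : Set σ))).IsPrime := by
  haveI : IsDomain (MvPowerSeries τ R) := NoZeroDivisors.to_isDomain _
  rw [← MvPowerSeries.ker_killCompl_eq_span e C hC]
  exact RingHom.ker_isPrime _

/-- A product of monomials with coefficient `1` is the monomial of the sum of the exponents.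
[folklore] -/
theorem MvPowerSeries.prod_monomial_one {ι : Type*} (s : Finset ι) (d : ι → σ →₀ ℕ) :
    ∏ i ∈ s, MvPowerSeries.monomial (d i) (1 : R) = MvPowerSeries.monomial (∑ i ∈ s, d i) 1 := by
  classical
  induction s using Finset.induction_on with
  | empty => simp
  | insert a s ha ih =>
    rw [Finset.prod_insert ha, Finset.sum_insert ha, ih, MvPowerSeries.monomial_mul_monomial,
      one_mul]

end Variables

/-! ## Quotients by an element of `𝔪²` are not regular -/

section RegularSq

variable {R : Type u} [CommRing R] [IsLocalRing R] [IsNoetherianRing R]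

/-- **Matsumura, Thm. 14.2, embedding-dimension count, for any Noetherian local ring**: for a
non-zero-divisor `x ∈ 𝔪²` the quotient `R/(x)` is not a regular local ring — its embedding
dimension is still `emb dim R ≥ dim R`, while its dimension is `≤ dim R - 1`.
[cite: Matsumura1987, Thm. 14.2] -/
theorem not_isRegularLocalRing_quotient_span_singleton_of_mem_sq' {x : R}
    (hx0 : x ∈ nonZeroDivisors R) (hx2 : x ∈ (maximalIdeal R) ^ 2) :
    ¬ IsRegularLocalRing (R ⧸ Ideal.span {x}) := by
  intro hreg
  have hx : x ∈ maximalIdeal R := Ideal.pow_le_self two_ne_zero hx2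
  haveI : Nontrivial (R ⧸ Ideal.span {x}) :=
    Ideal.Quotient.nontrivial_iff.mpr (Ideal.span_singleton_ne_top hx)
  have hdim := ringKrullDim_quotient_succ_le_of_nonZeroDivisor hx0
  have hR := ringKrullDim_le_spanFinrank_maximalIdeal R
  have hQ := (isRegularLocalRing_iff (R ⧸ Ideal.span {x})).mp hreg
  have hμ := spanFinrank_maximalIdeal_le_spanFinrank_map_of_mem_sq hx2
  rw [← maximalIdeal_quotient_eq_map (Ideal.span {x})] at hμ
  obtain ⟨n, hn⟩ := exists_nat_cast_eq_ringKrullDim (R := R ⧸ Ideal.span {x})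
  obtain ⟨d, hd⟩ := exists_nat_cast_eq_ringKrullDim (R := R)
  rw [hn, hd] at hdim
  rw [hd] at hR
  rw [hn] at hQ
  have h1 : d ≤ (maximalIdeal R).spanFinrank := by exact_mod_cast hR
  have h2 : (maximalIdeal (R ⧸ Ideal.span {x})).spanFinrank = n := by exact_mod_cast hQ
  have h3 : n + 1 ≤ d := by exact_mod_cast hdim
  omega

end RegularSq

/-! ## The prime `(u, v, tᵢ)` of the formal model -/

namespace DeJong1996

variable (k : Type u) [Field k] {m : ℕ}

/-- The ideal `(u, v, tᵢ)` of `k⟦u, v, t₁, …, t_m⟧`. [cite: DeJong1996, 3.4–3.5, pp. 63–64] -/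
def uvtIdeal (i : Fin m) : Ideal (MvPowerSeries (Fin 2 ⊕ Fin m) k) :=
  Ideal.span ((fun c => (MvPowerSeries.X c : MvPowerSeries (Fin 2 ⊕ Fin m) k)) ''
    (({Sum.inl 0, Sum.inl 1, Sum.inr i} : Finset (Fin 2 ⊕ Fin m)) : Set (Fin 2 ⊕ Fin m)))

variable {k}

/-- The variables `u`, `v`, `tᵢ` lie in `(u, v, tᵢ)`. [folklore] -/
theorem X_mem_uvtIdeal (i : Fin m) {c : Fin 2 ⊕ Fin m}
    (hc : c ∈ ({Sum.inl 0, Sum.inl 1, Sum.inr i} : Finset (Fin 2 ⊕ Fin m))) :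
    (MvPowerSeries.X c : MvPowerSeries (Fin 2 ⊕ Fin m) k) ∈ uvtIdeal k i :=
  Ideal.subset_span ⟨c, hc, rfl⟩

/-- `(u, v, tᵢ)` is a prime ideal of `k⟦u, v, t⟧` (the kernel of `tⱼ ↦ tⱼ` (`j ≠ i`),
`u, v, tᵢ ↦ 0`). [folklore] -/
theorem isPrime_uvtIdeal (i : Fin m) : (uvtIdeal k i).IsPrime := by
  let e : {j : Fin m // j ≠ i} ↪ Fin 2 ⊕ Fin m :=
    ⟨fun j => Sum.inr j.1, fun a b h => Subtype.ext (Sum.inr_injective h)⟩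
  refine MvPowerSeries.isPrime_span_X_image e _ fun s => ?_
  rcases s with a | j
  · constructor
    · rintro - ⟨b, hb⟩
      exact Sum.inr_ne_inl hb
    · intro _
      fin_cases a <;> simp
  · simp only [Finset.mem_insert, Finset.mem_singleton, Sum.inr.injEq, Set.mem_range,
      not_exists, reduceCtorEq, false_or]
    constructor
    · rintro rfl ⟨b, hb⟩ h
      exact hb (Sum.inr_injective h)
    · intro h
      by_contra hji
      exact h ⟨j, hji⟩ rfl

/-- `(u, v, tᵢ)` has height at most `3` (Krull's height theorem). [cite: Matsumura1987, Thm. 13.5] -/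
theorem height_uvtIdeal_le (i : Fin m) : (uvtIdeal k i).height ≤ 3 := by
  classical
  haveI : IsNoetherianRing (MvPowerSeries (Fin 2 ⊕ Fin m) k) :=
    isNoetherianRing_mvPowerSeries k (Fin 2 ⊕ Fin m)
  haveI := isPrime_uvtIdeal (k := k) i
  have hmin : uvtIdeal k i ∈ (uvtIdeal k i).minimalPrimes := by
    rw [Ideal.minimalPrimes_eq_subsingleton_self]
    exact Set.mem_singleton _
  unfold uvtIdeal at hmin ⊢
  rw [← Finset.coe_image] at hmin ⊢
  refine (Ideal.height_le_card_of_mem_minimalPrimes_span_finset hmin).trans ?_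
  exact_mod_cast (Finset.card_image_le.trans (by simp))

/-- The relation `F = uv - ∏ⱼ tⱼ^{nnⱼ}` lies in `(u, v, tᵢ)²` as soon as `nnᵢ ≥ 2`.
[cite: DeJong1996, 3.5, p. 64] -/
theorem nodalRelationPow_mem_sq (nn : Fin m → ℕ) (i : Fin m) (hi : 2 ≤ nn i) :
    nodalRelationPow k m nn ∈ uvtIdeal k i ^ 2 := by
  classical
  have hu := X_mem_uvtIdeal (k := k) i (c := Sum.inl 0) (by simp)
  have hv := X_mem_uvtIdeal (k := k) i (c := Sum.inl 1) (by simp)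
  have ht := X_mem_uvtIdeal (k := k) i (c := Sum.inr i) (by simp)
  refine Ideal.sub_mem _ ?_ ?_
  · rw [pow_two]
    exact Ideal.mul_mem_mul hu hv
  · rw [← Finset.mul_prod_erase Finset.univ _ (Finset.mem_univ i)]
    refine Ideal.mul_mem_right _ _ ?_
    rw [show nn i = 2 + (nn i - 2) by omega, pow_add]
    exact Ideal.mul_mem_right _ _ (Ideal.pow_mem_pow ht 2)

/-- The relation `F = uv - ∏ⱼ tⱼ^{nnⱼ}` is non-zero: its coefficient at `uv` is `1`.
[folklore] -/
theorem nodalRelationPow_ne_zero (nn : Fin m → ℕ) : nodalRelationPow k m nn ≠ 0 := by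
  classical
  intro h
  let x : Fin 2 ⊕ Fin m →₀ ℕ := Finsupp.single (Sum.inl 0) 1 + Finsupp.single (Sum.inl 1) 1
  have h1 : MvPowerSeries.coeff x (nodalRelationPow k m nn) = 1 := by
    have hprod : (∏ j, MvPowerSeries.X (Sum.inr j) ^ nn j :
        MvPowerSeries (Fin 2 ⊕ Fin m) k) =
        MvPowerSeries.monomial (∑ j, Finsupp.single (Sum.inr j) (nn j)) 1 := by
      rw [← MvPowerSeries.prod_monomial_one]
      exact Finset.prod_congr rfl fun j _ => MvPowerSeries.X_pow_eq _ _
    have huv : (MvPowerSeries.X (Sum.inl 0) * MvPowerSeries.X (Sum.inl 1) :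
        MvPowerSeries (Fin 2 ⊕ Fin m) k) = MvPowerSeries.monomial x 1 := by
      rw [MvPowerSeries.X, MvPowerSeries.X, MvPowerSeries.monomial_mul_monomial, one_mul]
    have hne : x ≠ ∑ j, Finsupp.single (Sum.inr j) (nn j) := by
      intro hx
      have := DFunLike.congr_fun hx (Sum.inl 0)
      simp [x, Finsupp.finsetSum_apply] at this
    rw [nodalRelationPow, map_sub, hprod, huv, MvPowerSeries.coeff_monomial_same,
      MvPowerSeries.coeff_monomial, if_neg hne, sub_zero]
  rw [h, map_zero] at h1
  exact zero_ne_one h1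

/-- `(F) ⊆ (u, v, tᵢ)` when `nnᵢ ≥ 2`. [folklore] -/
theorem span_nodalRelationPow_le (nn : Fin m → ℕ) (i : Fin m) (hi : 2 ≤ nn i) :
    Ideal.span {nodalRelationPow k m nn} ≤ uvtIdeal k i := by
  rw [Ideal.span_le, Set.singleton_subset_iff]
  exact Ideal.pow_le_self two_ne_zero (nodalRelationPow_mem_sq nn i hi)

/-- **The singular prime of codimension two.** If `nnᵢ ≥ 2`, the image `𝔓` of `(u, v, tᵢ)` in
`B = k⟦u, v, t₁, …, t_m⟧/(uv - ∏ⱼ tⱼ^{nnⱼ})` is a prime ideal with `B_𝔓` not regular and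
`dim B_𝔓 ≤ 2` ("In the equations above `X` is singular along `u = v = t₁ = t₂ = 0`", 3.5; the
integer `nᵢ` must be `≤ 1` for `codim(Sing(X), X) ≥ 3`). Proof: `B_𝔓 ≅ k⟦u, v, t⟧_P/(F)` with
`P = (u, v, tᵢ)` of height `≤ 3` and `0 ≠ F ∈ P²`. [cite: DeJong1996, 3.5, p. 64] -/
theorem exists_prime_nodalPowRing_not_isRegularLocalRing (nn : Fin m → ℕ) (i : Fin m)
    (hi : 2 ≤ nn i) :
    ∃ (𝔓 : Ideal (NodalPowRing k m nn)) (_ : 𝔓.IsPrime),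
      ¬ IsRegularLocalRing (Localization.AtPrime 𝔓) ∧
        ringKrullDim (Localization.AtPrime 𝔓) ≤ 2 := by
  classical
  set R := MvPowerSeries (Fin 2 ⊕ Fin m) k with hR
  haveI : IsNoetherianRing R := isNoetherianRing_mvPowerSeries k (Fin 2 ⊕ Fin m)
  set F : R := nodalRelationPow k m nn with hF
  set I : Ideal R := Ideal.span {F} with hI
  set P : Ideal R := uvtIdeal k i with hP
  haveI hPp : P.IsPrime := isPrime_uvtIdeal i
  have hIP : I ≤ P := span_nodalRelationPow_le nn i hi
  -- the prime `𝔓 = P/(F)` of `B`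
  let 𝔓 : Ideal (NodalPowRing k m nn) := P.map (Ideal.Quotient.mk I)
  have hker : RingHom.ker (Ideal.Quotient.mk I) ≤ P := by rwa [Ideal.mk_ker]
  haveI h𝔓 : 𝔓.IsPrime := Ideal.map_isPrime_of_surjective Ideal.Quotient.mk_surjective hker
  have hQP : 𝔓.comap (Ideal.Quotient.mk I) = P := by
    change (P.map (Ideal.Quotient.mk I)).comap (Ideal.Quotient.mk I) = P
    rw [Ideal.comap_map_of_surjective _ Ideal.Quotient.mk_surjective, ← RingHom.ker_eq_comap_bot,
      Ideal.mk_ker]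
    exact sup_eq_left.mpr hIP
  set Q : Ideal R := 𝔓.comap (Ideal.Quotient.mk I) with hQ
  haveI hQp : Q.IsPrime := Ideal.comap_isPrime _ 𝔓
  set RQ := Localization.AtPrime Q
  -- `0 ≠ F ∈ 𝔪² ⊆ R_Q`
  have hinj : Function.Injective (algebraMap R RQ) :=
    IsLocalization.injective RQ Q.primeCompl_le_nonZeroDivisors
  have hF0 : algebraMap R RQ F ≠ 0 := fun h =>
    nodalRelationPow_ne_zero nn (hinj (h.trans (map_zero _).symm))
  have hF0' : algebraMap R RQ F ∈ nonZeroDivisors RQ := mem_nonZeroDivisors_of_ne_zero hF0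
  have hF2 : algebraMap R RQ F ∈ maximalIdeal RQ ^ 2 := by
    rw [← Localization.AtPrime.map_eq_maximalIdeal, ← Ideal.map_pow]
    refine Ideal.mem_map_of_mem _ ?_
    have h2 : F ∈ P ^ 2 := nodalRelationPow_mem_sq nn i hi
    rw [← hQP] at h2
    exact h2
  refine ⟨𝔓, h𝔓, fun hreg => ?_, ?_⟩
  · -- `B_𝔓 ≅ R_Q/(F)` would be regular
    have h1 := isRegularLocalRing_localization_quotient_span_singleton F 𝔓
    exact not_isRegularLocalRing_quotient_span_singleton_of_mem_sq' hF0' hF2 h1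
  · -- `dim B_𝔓 = dim R_Q/(F) ≤ ht Q - 1 ≤ 2`
    have hsub : Algebra.algebraMapSubmonoid (R ⧸ I) Q.primeCompl = 𝔓.primeCompl := by
      ext y
      constructor
      · rintro ⟨c, hc, rfl⟩
        exact hc
      · intro hy
        obtain ⟨c, rfl⟩ := Ideal.Quotient.mk_surjective y
        exact ⟨c, hy, rfl⟩
    haveI : IsLocalization.AtPrime (RQ ⧸ I.map (algebraMap R RQ)) 𝔓 := by
      change IsLocalization 𝔓.primeCompl _
      rw [← hsub]
      infer_instance
    let e := IsLocalization.algEquiv 𝔓.primeCompl (Localization.AtPrime 𝔓)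
      (RQ ⧸ I.map (algebraMap R RQ))
    have hmap : I.map (algebraMap R RQ) = Ideal.span {algebraMap R RQ F} := by
      rw [hI, Ideal.map_span, Set.image_singleton]
    have e' : Localization.AtPrime 𝔓 ≃+* RQ ⧸ Ideal.span {algebraMap R RQ F} :=
      e.toRingEquiv.trans (Ideal.quotEquivOfEq hmap)
    rw [ringKrullDim_eq_of_ringEquiv (R := Localization.AtPrime 𝔓)
      (S := RQ ⧸ Ideal.span {algebraMap R RQ F}) e']
    have hdim := ringKrullDim_quotient_succ_le_of_nonZeroDivisor hF0'
    have hRQ : ringKrullDim RQ = Q.height := IsLocalization.AtPrime.ringKrullDim_eq_height Q RQ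
    have hQh : Q.height ≤ 3 := by
      rw [show Q = P from hQP]
      exact height_uvtIdeal_le i
    haveI : IsLocalRing (RQ ⧸ Ideal.span {algebraMap R RQ F}) :=
      isLocalRing_quotient (Ideal.span_singleton_ne_top (Ideal.pow_le_self two_ne_zero hF2))
    obtain ⟨n, hn⟩ := exists_nat_cast_eq_ringKrullDim (R := RQ ⧸ Ideal.span {algebraMap R RQ F})
    obtain ⟨h3, hh3⟩ := ENat.ne_top_iff_exists.mp (ne_top_of_le_ne_top (by decide) hQh)
    rw [hn] at hdim ⊢
    rw [hRQ, ← hh3] at hdim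
    have hQh' : h3 ≤ 3 := by
      rw [← hh3] at hQh
      exact_mod_cast hQh
    have hdim' : n + 1 ≤ h3 := by
      have : ((n : ℕ∞) : WithBot ℕ∞) + 1 ≤ ((h3 : ℕ∞) : WithBot ℕ∞) := hdim
      exact_mod_cast this
    have : n ≤ 2 := by omega
    exact_mod_cast this

end DeJong1996

end Literature.AlgebraicGeometry.Resolution

end
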